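import Summits.Ventures.LatticeQCDFlow.Exactness.FlowSamplerSymmetrisationDirichlet
import Summits.Ventures.LatticeQCDFlow.Exactness.ReversibleComparison
import HarnessLib

/-!
# MIX THE FLOWS, DON'T ALTERNATE THEM: the exact flow sampler with the MIXTURE proposal `a q̃₁ + (1 − a) q̃₂` never has a larger `τ_int` than the random alternation of the two flow samplers (Tierney 1998 Prop. 5 on a general state space, for the independence sampler on `L²(w)`)

HONEST FRAMING: exact (Metropolis-corrected) sampling algorithms for lattice gauge theory;
figures of merit are autocorrelation/cost numbers at stated couplings and volumes; no
continuum-physics claim.  (SCALAR calibration rung S0-A: not a gauge result.)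

Venture `LatticeQCDFlow` (cell pub-lqcd), topic `Exactness`; FANOUT row 2 (`s0-phi4`, FLOW arm).
NEW WORK of the cell.  Two trained flows `q̃₁, q̃₂ > 0` (e.g. two mode-collapsed flows, one per well —
the 'mixtures of multiple models' of Hackett et al. 2021 §4.1, NAMED) can be combined in two exact
ways: (MIX) one independence sampler with the mixture density `q̄ = a q̃₁ + (1 − a) q̃₂` as proposal,
`K_q̄ = imhOp μ w q̄`; (ALT) at each step pick flow 1 with probability `a`, else flow 2, and do that
flow's exact step: the kernel mixture `K_alt = a K_{q̃₁} + (1 − a) K_{q̃₂}`.  Both are `π`-invariant and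
reversible.  The printed statement (Tierney 1998, Ann. Appl. Probab. 8, Prop. 5; Liu 2001 Thm 13.3.4;
finite-state formalisation in the tree: `Literature.Probability.MarkovChains.MixtureProposalPeskun`)
is that (MIX) Peskun-dominates (ALT).  Here, on a general s-finite measure space and on all of
`L²(w)`: the symmetrised flows satisfy `s_q̄ ≥ a s_{q̃₁} + (1 − a) s_{q̃₂}` pointwise (`min` is
superadditive), hence the Dirichlet forms `𝓔_q̄ ≥ a 𝓔₁ + (1 − a) 𝓔₂ = 𝓔_alt` on the whole class, and
the tree's format-level comparison machinery (`ReversibleComparison`, `ReversibleVariationalTauInt`,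
`ReversibleVariationalCeilingPositive`) does the rest.  Nothing is cited as a fact.

## What is proved (`w, q̃₁, q̃₂ > 0` measurable, `w, q̃ᵢ ∈ L¹`, `∫ q̃ᵢ = 1`, `0 ≤ a ≤ 1`;
class `A = {measurable, ∫ v² w < ∞}`)

* `mixture_facts` — `q̄ > 0`, measurable, integrable, `∫ q̄ = 1`;
* `altOp_*` — (ALT) satisfies the `RevOp` hypotheses (stability, linearity, symmetry, contraction);
* `mixture_imhFlow_ge`, **`mixture_dirichlet_ge_alt`** — `𝓔_alt(v) ≤ 𝓔_q̄(v)` for every `v ∈ A`;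
* **`mixture_abelSum_le_alt`** — UNCONDITIONAL, Abel form: for every `g ∈ A`, `0 ≤ r < 1`:
  `Σ_k C_q̄(k) rᵏ ≤ Σ_k C_alt(k) rᵏ` (`RevOp.abelSum_le_of_dirichlet_le`);
* **`mixture_tauInt_le_alt`** — for every `g ∈ A` with `∫ g² w > 0` whose normalised series under
  (ALT) is summable: the series under (MIX) is summable too and **`τ_int^{MIX}(g) ≤ τ_int^{ALT}(g)`**
  (sharp variational inequality for (ALT) + positivity of (MIX): one-sided summability suffices).

Reading for S0-A / multi-flow designs (no numerics implied): given several trained flows for an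
exact sampler of one target, proposing from their mixture density is, per step, never worse in
`τ_int` of ANY square-integrable observable than alternating between them at random with the same
weights — at the price of evaluating every flow's density at each proposal (Tierney's printed caution,
NAMED).  NOT CLAIMED: comparison with deterministic alternation (not reversible); any value for any
network; more than two components (the `N`-component statement is the same argument); cost.
-/

namespace Summit.Ventures.LatticeQCDFlow.Exactness

open Real MeasureTheory Filter Finset Set Topology
open Summit.Ventures.LatticeQCDFlow.Scoring

section General

variable {X : Type*} [MeasurableSpace X] {μ : Measure X} [SFinite μ] {w q₁ q₂ : X → ℝ} {a : ℝ}

/-! ## §1 The mixture density and the alternation operator -/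

omit [SFinite μ] in
/-- `q̄ = a q̃₁ + (1 − a) q̃₂` is a positive, measurable, normalised density (`0 ≤ a ≤ 1`). -/
theorem mixture_facts (ha0 : 0 ≤ a) (ha1 : a ≤ 1) (hq1p : ∀ t, 0 < q₁ t) (hq1m : Measurable q₁)
    (hq1i : Integrable q₁ μ) (hq1n : ∫ t, q₁ t ∂μ = 1) (hq2p : ∀ t, 0 < q₂ t) (hq2m : Measurable q₂)
    (hq2i : Integrable q₂ μ) (hq2n : ∫ t, q₂ t ∂μ = 1) :
    (∀ t, 0 < a * q₁ t + (1 - a) * q₂ t) ∧ Measurable (fun t => a * q₁ t + (1 - a) * q₂ t) ∧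
    Integrable (fun t => a * q₁ t + (1 - a) * q₂ t) μ ∧ (∫ t, a * q₁ t + (1 - a) * q₂ t ∂μ = 1) := by
  refine ⟨fun t => ?_, (hq1m.const_mul a).add (hq2m.const_mul _),
    (hq1i.const_mul a).add (hq2i.const_mul _), ?_⟩
  · rcases eq_or_lt_of_le ha0 with h | h
    · rw [← h]; simp only [zero_mul, sub_zero, one_mul, zero_add]; exact hq2p t
    · exact add_pos_of_pos_of_nonneg (mul_pos h (hq1p t))
        (mul_nonneg (sub_nonneg.2 ha1) (hq2p t).le)
  · rw [integral_add (hq1i.const_mul a) (hq2i.const_mul _), integral_const_mul, integral_const_mul,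
      hq1n, hq2n]
    ring

/-- (ALT) is stable on the square-integrable class. -/
theorem altOp_stab (hw0 : ∀ t, 0 < w t) (hwm : Measurable w) (hwi : Integrable w μ)
    (hq1p : ∀ t, 0 < q₁ t) (hq1m : Measurable q₁) (hq1i : Integrable q₁ μ) (hq1n : ∫ t, q₁ t ∂μ = 1)
    (hq2p : ∀ t, 0 < q₂ t) (hq2m : Measurable q₂) (hq2i : Integrable q₂ μ) (hq2n : ∫ t, q₂ t ∂μ = 1)
    (a : ℝ) :
    ∀ ⦃f : X → ℝ⦄, (Measurable f ∧ Integrable (fun t => f t ^ 2 * w t) μ) →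
      (Measurable (fun x => a * imhOp μ w q₁ f x + (1 - a) * imhOp μ w q₂ f x) ∧
        Integrable (fun t => (a * imhOp μ w q₁ f t + (1 - a) * imhOp μ w q₂ f t) ^ 2 * w t) μ) := by
  intro f hf
  have h1 := sqClass_stab hw0 hwm hwi hq1p hq1m hq1i hq1n hf
  have h2 := sqClass_stab hw0 hwm hwi hq2p hq2m hq2i hq2n hf
  have hz : Measurable (fun _ : X => (0 : ℝ)) ∧ Integrable (fun t => (0 : ℝ) ^ 2 * w t) μ :=
    ⟨measurable_const, by simp⟩
  have h1' := sqClass_comb hw0 hwm a hz h1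
  have h12 := sqClass_comb hw0 hwm (1 - a) h1' h2
  simp only [zero_add] at h12
  exact h12

omit [SFinite μ] in
/-- (ALT) is linear on the class. -/
theorem altOp_lin (hw0 : ∀ t, 0 < w t) (hwm : Measurable w) (hwi : Integrable w μ)
    (hq1p : ∀ t, 0 < q₁ t) (hq1m : Measurable q₁) (hq1i : Integrable q₁ μ)
    (hq2p : ∀ t, 0 < q₂ t) (hq2m : Measurable q₂) (hq2i : Integrable q₂ μ) (a : ℝ) :
    ∀ ⦃f h : X → ℝ⦄ (c : ℝ), (Measurable f ∧ Integrable (fun t => f t ^ 2 * w t) μ) →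
      (Measurable h ∧ Integrable (fun t => h t ^ 2 * w t) μ) → ∀ x,
      (a * imhOp μ w q₁ (fun s => f s + c * h s) x + (1 - a) * imhOp μ w q₂ (fun s => f s + c * h s) x)
        = (a * imhOp μ w q₁ f x + (1 - a) * imhOp μ w q₂ f x)
          + c * (a * imhOp μ w q₁ h x + (1 - a) * imhOp μ w q₂ h x) := by
  intro f h c hf hh x
  rw [sqClass_lin hw0 hwm hwi hq1p hq1m hq1i c hf hh x, sqClass_lin hw0 hwm hwi hq2p hq2m hq2i c hf hh x]
  ring

/-- (ALT) is symmetric on the class (`w`-self-adjoint). -/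
theorem altOp_symm (hw0 : ∀ t, 0 < w t) (hwm : Measurable w) (hwi : Integrable w μ)
    (hq1p : ∀ t, 0 < q₁ t) (hq1m : Measurable q₁) (hq1i : Integrable q₁ μ) (hq1n : ∫ t, q₁ t ∂μ = 1)
    (hq2p : ∀ t, 0 < q₂ t) (hq2m : Measurable q₂) (hq2i : Integrable q₂ μ) (hq2n : ∫ t, q₂ t ∂μ = 1)
    (a : ℝ) :
    ∀ ⦃f h : X → ℝ⦄, (Measurable f ∧ Integrable (fun t => f t ^ 2 * w t) μ) →
      (Measurable h ∧ Integrable (fun t => h t ^ 2 * w t) μ) →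
      ∫ x, (a * imhOp μ w q₁ f x + (1 - a) * imhOp μ w q₂ f x) * h x * w x ∂μ
        = ∫ x, f x * (a * imhOp μ w q₁ h x + (1 - a) * imhOp μ w q₂ h x) * w x ∂μ := by
  intro f h hf hh
  have i1 := sqClass_int hw0 hwm (sqClass_stab hw0 hwm hwi hq1p hq1m hq1i hq1n hf) hh
  have i2 := sqClass_int hw0 hwm (sqClass_stab hw0 hwm hwi hq2p hq2m hq2i hq2n hf) hh
  have j1 := sqClass_int hw0 hwm hf (sqClass_stab hw0 hwm hwi hq1p hq1m hq1i hq1n hh)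
  have j2 := sqClass_int hw0 hwm hf (sqClass_stab hw0 hwm hwi hq2p hq2m hq2i hq2n hh)
  have e1 : ∀ x, (a * imhOp μ w q₁ f x + (1 - a) * imhOp μ w q₂ f x) * h x * w x
      = a * (imhOp μ w q₁ f x * h x * w x) + (1 - a) * (imhOp μ w q₂ f x * h x * w x) :=
    fun x => by ring
  have e2 : ∀ x, f x * (a * imhOp μ w q₁ h x + (1 - a) * imhOp μ w q₂ h x) * w x
      = a * (f x * imhOp μ w q₁ h x * w x) + (1 - a) * (f x * imhOp μ w q₂ h x * w x) :=
    fun x => by ring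
  simp_rw [e1, e2]
  rw [integral_add (i1.const_mul a) (i2.const_mul _), integral_add (j1.const_mul a) (j2.const_mul _),
    integral_const_mul, integral_const_mul, integral_const_mul, integral_const_mul,
    sqClass_symm hw0 hwm hwi hq1p hq1m hq1i hq1n hf hh, sqClass_symm hw0 hwm hwi hq2p hq2m hq2i hq2n hf hh]

/-- (ALT) is a contraction of `L²(w)` (convexity of the square, `0 ≤ a ≤ 1`). -/
theorem altOp_contr (hw0 : ∀ t, 0 < w t) (hwm : Measurable w) (hwi : Integrable w μ)
    (hq1p : ∀ t, 0 < q₁ t) (hq1m : Measurable q₁) (hq1i : Integrable q₁ μ) (hq1n : ∫ t, q₁ t ∂μ = 1)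
    (hq2p : ∀ t, 0 < q₂ t) (hq2m : Measurable q₂) (hq2i : Integrable q₂ μ) (hq2n : ∫ t, q₂ t ∂μ = 1)
    (ha0 : 0 ≤ a) (ha1 : a ≤ 1) :
    ∀ ⦃f : X → ℝ⦄, (Measurable f ∧ Integrable (fun t => f t ^ 2 * w t) μ) →
      ∫ x, (a * imhOp μ w q₁ f x + (1 - a) * imhOp μ w q₂ f x) ^ 2 * w x ∂μ
        ≤ ∫ x, f x ^ 2 * w x ∂μ := by
  intro f hf
  have h1 := sqClass_stab hw0 hwm hwi hq1p hq1m hq1i hq1n hf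
  have h2 := sqClass_stab hw0 hwm hwi hq2p hq2m hq2i hq2n hf
  have c1 := sqClass_contr hw0 hwm hwi hq1p hq1m hq1i hq1n hf
  have c2 := sqClass_contr hw0 hwm hwi hq2p hq2m hq2i hq2n hf
  have h12 := altOp_stab hw0 hwm hwi hq1p hq1m hq1i hq1n hq2p hq2m hq2i hq2n a hf
  -- pointwise `(a u + (1−a) v)² ≤ a u² + (1−a) v²`
  have hpt : ∀ x, (a * imhOp μ w q₁ f x + (1 - a) * imhOp μ w q₂ f x) ^ 2 * w x
      ≤ a * (imhOp μ w q₁ f x ^ 2 * w x) + (1 - a) * (imhOp μ w q₂ f x ^ 2 * w x) := fun x => by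
    have key : (a * imhOp μ w q₁ f x + (1 - a) * imhOp μ w q₂ f x) ^ 2
        ≤ a * imhOp μ w q₁ f x ^ 2 + (1 - a) * imhOp μ w q₂ f x ^ 2 := by
      nlinarith [sq_nonneg (imhOp μ w q₁ f x - imhOp μ w q₂ f x), mul_nonneg ha0 (sub_nonneg.2 ha1)]
    have h := mul_le_mul_of_nonneg_right key (hw0 x).le
    linarith
  calc ∫ x, (a * imhOp μ w q₁ f x + (1 - a) * imhOp μ w q₂ f x) ^ 2 * w x ∂μ
      ≤ ∫ x, a * (imhOp μ w q₁ f x ^ 2 * w x) + (1 - a) * (imhOp μ w q₂ f x ^ 2 * w x) ∂μ :=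
        integral_mono h12.2 ((h1.2.const_mul a).add (h2.2.const_mul _)) hpt
    _ = a * ∫ x, imhOp μ w q₁ f x ^ 2 * w x ∂μ + (1 - a) * ∫ x, imhOp μ w q₂ f x ^ 2 * w x ∂μ := by
        rw [integral_add (h1.2.const_mul a) (h2.2.const_mul _), integral_const_mul, integral_const_mul]
    _ ≤ a * ∫ x, f x ^ 2 * w x ∂μ + (1 - a) * ∫ x, f x ^ 2 * w x ∂μ :=
        add_le_add (mul_le_mul_of_nonneg_left c1 ha0) (mul_le_mul_of_nonneg_left c2 (sub_nonneg.2 ha1))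
    _ = ∫ x, f x ^ 2 * w x ∂μ := by ring

/-! ## §2 Dirichlet-form domination `𝓔_alt ≤ 𝓔_q̄` -/

omit [MeasurableSpace X] [SFinite μ] in
/-- `a s_{q̃₁} + (1 − a) s_{q̃₂} ≤ s_q̄` pointwise (`min` superadditive, `0 ≤ a ≤ 1`). -/
theorem mixture_imhFlow_ge (ha0 : 0 ≤ a) (ha1 : a ≤ 1) (x y : X) :
    a * imhFlow w q₁ x y + (1 - a) * imhFlow w q₂ x y
      ≤ imhFlow w (fun t => a * q₁ t + (1 - a) * q₂ t) x y := by
  unfold imhFlow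
  beta_reduce
  have hb : 0 ≤ 1 - a := sub_nonneg.2 ha1
  rw [mul_min_of_nonneg _ _ ha0, mul_min_of_nonneg _ _ hb]
  have h := min_add_min_le_min_add (a * (w x * q₁ y)) ((1 - a) * (w x * q₂ y))
    (a * (w y * q₁ x)) ((1 - a) * (w y * q₂ x))
  have e1 : a * (w x * q₁ y) + (1 - a) * (w x * q₂ y) = w x * (a * q₁ y + (1 - a) * q₂ y) := by ring
  have e2 : a * (w y * q₁ x) + (1 - a) * (w y * q₂ x) = w y * (a * q₁ x + (1 - a) * q₂ x) := by ring
  rw [e1, e2] at h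
  exact h

/-- **`𝓔_alt(v) ≤ 𝓔_q̄(v)` for every square-integrable `v`**:
`∫ v² w − ∫ v (K_alt v) w ≤ ∫ v² w − ∫ v (K_q̄ v) w`. -/
theorem mixture_dirichlet_ge_alt (hw0 : ∀ t, 0 < w t) (hwm : Measurable w) (hwi : Integrable w μ)
    (hq1p : ∀ t, 0 < q₁ t) (hq1m : Measurable q₁) (hq1i : Integrable q₁ μ) (hq1n : ∫ t, q₁ t ∂μ = 1)
    (hq2p : ∀ t, 0 < q₂ t) (hq2m : Measurable q₂) (hq2i : Integrable q₂ μ) (hq2n : ∫ t, q₂ t ∂μ = 1)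
    (ha0 : 0 ≤ a) (ha1 : a ≤ 1) {v : X → ℝ} (hvm : Measurable v)
    (hv2 : Integrable (fun t => v t ^ 2 * w t) μ) :
    (∫ t, v t ^ 2 * w t ∂μ) - ∫ t, v t * (a * imhOp μ w q₁ v t + (1 - a) * imhOp μ w q₂ v t) * w t ∂μ
      ≤ (∫ t, v t ^ 2 * w t ∂μ)
        - ∫ t, v t * imhOp μ w (fun s => a * q₁ s + (1 - a) * q₂ s) v t * w t ∂μ := by
  obtain ⟨hs0, hsm, hsi, hs1⟩ := mixture_facts (μ := μ) ha0 ha1 hq1p hq1m hq1i hq1n hq2p hq2m hq2i hq2n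
  -- split the (ALT) inner product and use the two Dirichlet representations
  have j1 := sqClass_int hw0 hwm ⟨hvm, hv2⟩ (sqClass_stab hw0 hwm hwi hq1p hq1m hq1i hq1n ⟨hvm, hv2⟩)
  have j2 := sqClass_int hw0 hwm ⟨hvm, hv2⟩ (sqClass_stab hw0 hwm hwi hq2p hq2m hq2i hq2n ⟨hvm, hv2⟩)
  have e : ∫ t, v t * (a * imhOp μ w q₁ v t + (1 - a) * imhOp μ w q₂ v t) * w t ∂μ
      = a * ∫ t, v t * imhOp μ w q₁ v t * w t ∂μ + (1 - a) * ∫ t, v t * imhOp μ w q₂ v t * w t ∂μ := by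
    have e' : ∀ t, v t * (a * imhOp μ w q₁ v t + (1 - a) * imhOp μ w q₂ v t) * w t
        = a * (v t * imhOp μ w q₁ v t * w t) + (1 - a) * (v t * imhOp μ w q₂ v t * w t) :=
      fun t => by ring
    simp_rw [e']
    rw [integral_add (j1.const_mul a) (j2.const_mul _), integral_const_mul, integral_const_mul]
  have d1 := dirichlet_eq_half_sq_of_sq hw0 hwm hwi hq1p hq1m hq1i hq1n hvm hv2
  have d2 := dirichlet_eq_half_sq_of_sq hw0 hwm hwi hq2p hq2m hq2i hq2n hvm hv2
  have dm := dirichlet_eq_half_sq_of_sq hw0 hwm hwi hs0 hsm hsi hs1 hvm hv2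
  have I1 := integrable_imhFlow_mul_sq_sub hw0 hwm hq1p hq1m hq1i hvm hv2
  have I2 := integrable_imhFlow_mul_sq_sub hw0 hwm hq2p hq2m hq2i hvm hv2
  have Im := integrable_imhFlow_mul_sq_sub hw0 hwm hs0 hsm hsi hvm hv2
  -- `𝓔_alt = a 𝓔₁ + (1−a) 𝓔₂`
  have halt : (∫ t, v t ^ 2 * w t ∂μ)
      - ∫ t, v t * (a * imhOp μ w q₁ v t + (1 - a) * imhOp μ w q₂ v t) * w t ∂μ
      = a * ((1 / 2) * ∫ p, imhFlow w q₁ p.1 p.2 * (v p.1 - v p.2) ^ 2 ∂(μ.prod μ))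
        + (1 - a) * ((1 / 2) * ∫ p, imhFlow w q₂ p.1 p.2 * (v p.1 - v p.2) ^ 2 ∂(μ.prod μ)) := by
    rw [e, ← d1, ← d2]
    ring
  rw [halt, dm]
  have hpt : ∀ p : X × X, a * (imhFlow w q₁ p.1 p.2 * (v p.1 - v p.2) ^ 2)
      + (1 - a) * (imhFlow w q₂ p.1 p.2 * (v p.1 - v p.2) ^ 2)
        ≤ imhFlow w (fun s => a * q₁ s + (1 - a) * q₂ s) p.1 p.2 * (v p.1 - v p.2) ^ 2 := fun p => by
    have h := mixture_imhFlow_ge (w := w) (q₁ := q₁) (q₂ := q₂) ha0 ha1 p.1 p.2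
    have e' : a * (imhFlow w q₁ p.1 p.2 * (v p.1 - v p.2) ^ 2)
        + (1 - a) * (imhFlow w q₂ p.1 p.2 * (v p.1 - v p.2) ^ 2)
        = (a * imhFlow w q₁ p.1 p.2 + (1 - a) * imhFlow w q₂ p.1 p.2) * (v p.1 - v p.2) ^ 2 := by ring
    rw [e']
    exact mul_le_mul_of_nonneg_right h (sq_nonneg _)
  have hle : a * ∫ p, imhFlow w q₁ p.1 p.2 * (v p.1 - v p.2) ^ 2 ∂(μ.prod μ)
      + (1 - a) * ∫ p, imhFlow w q₂ p.1 p.2 * (v p.1 - v p.2) ^ 2 ∂(μ.prod μ)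
        ≤ ∫ p, imhFlow w (fun s => a * q₁ s + (1 - a) * q₂ s) p.1 p.2 * (v p.1 - v p.2) ^ 2
          ∂(μ.prod μ) := by
    rw [← integral_const_mul, ← integral_const_mul, ← integral_add (I1.const_mul a) (I2.const_mul _)]
    exact integral_mono ((I1.const_mul a).add (I2.const_mul _)) Im hpt
  linarith

/-! ## §3 The comparison -/

/-- **UNCONDITIONAL, ABEL FORM**: for every square-integrable `g` and `0 ≤ r < 1`,
`Σ_k C_q̄(k) rᵏ ≤ Σ_k C_alt(k) rᵏ` — the mixture proposal has the smaller Abel autocorrelation sums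
(`RevOp.abelSum_le_of_dirichlet_le`, Peskun–Tierney in Abel form). -/
theorem mixture_abelSum_le_alt (hw0 : ∀ t, 0 < w t) (hwm : Measurable w) (hwi : Integrable w μ)
    (hq1p : ∀ t, 0 < q₁ t) (hq1m : Measurable q₁) (hq1i : Integrable q₁ μ) (hq1n : ∫ t, q₁ t ∂μ = 1)
    (hq2p : ∀ t, 0 < q₂ t) (hq2m : Measurable q₂) (hq2i : Integrable q₂ μ) (hq2n : ∫ t, q₂ t ∂μ = 1)
    (ha0 : 0 ≤ a) (ha1 : a ≤ 1) {g : X → ℝ} (hgm : Measurable g)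
    (hg2 : Integrable (fun t => g t ^ 2 * w t) μ) {r : ℝ} (hr0 : 0 ≤ r) (hr1 : r < 1) :
    ∑' k, (∫ x, g x * ((imhOp μ w (fun s => a * q₁ s + (1 - a) * q₂ s))^[k] g) x * w x ∂μ) * r ^ k
      ≤ ∑' k, (∫ x, g x * ((fun f : X → ℝ => fun x =>
          a * imhOp μ w q₁ f x + (1 - a) * imhOp μ w q₂ f x)^[k] g) x * w x ∂μ) * r ^ k := by
  obtain ⟨hs0, hsm, hsi, hs1⟩ := mixture_facts (μ := μ) ha0 ha1 hq1p hq1m hq1i hq1n hq2p hq2m hq2i hq2n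
  exact RevOp.abelSum_le_of_dirichlet_le (A := fun f : X → ℝ =>
      Measurable f ∧ Integrable (fun t => f t ^ 2 * w t) μ)
    (K := fun f : X → ℝ => fun x => a * imhOp μ w q₁ f x + (1 - a) * imhOp μ w q₂ f x)
    (K' := imhOp μ w (fun s => a * q₁ s + (1 - a) * q₂ s))
    (fun x => (hw0 x).le) (sqClass_int hw0 hwm) (sqClass_comb hw0 hwm)
    (altOp_stab hw0 hwm hwi hq1p hq1m hq1i hq1n hq2p hq2m hq2i hq2n a)
    (altOp_lin hw0 hwm hwi hq1p hq1m hq1i hq2p hq2m hq2i a)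
    (altOp_symm hw0 hwm hwi hq1p hq1m hq1i hq1n hq2p hq2m hq2i hq2n a)
    (altOp_contr hw0 hwm hwi hq1p hq1m hq1i hq1n hq2p hq2m hq2i hq2n ha0 ha1)
    (sqClass_stab hw0 hwm hwi hs0 hsm hsi hs1) (sqClass_lin hw0 hwm hwi hs0 hsm hsi)
    (sqClass_symm hw0 hwm hwi hs0 hsm hsi hs1) (sqClass_contr hw0 hwm hwi hs0 hsm hsi hs1)
    (fun v hv => mixture_dirichlet_ge_alt hw0 hwm hwi hq1p hq1m hq1i hq1n hq2p hq2m hq2i hq2n ha0 ha1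
      hv.1 hv.2)
    ⟨hgm, hg2⟩ hr0 hr1

/-- **MIX THE FLOWS, DON'T ALTERNATE THEM**: for every square-integrable `g` with `∫ g² w > 0` whose
normalised autocorrelation series under the alternation `a K_{q̃₁} + (1 − a) K_{q̃₂}` is summable, the
series under the mixture-proposal sampler `imhOp μ w (a q̃₁ + (1 − a) q̃₂)` is summable and
**`τ_int^{MIX}(g) ≤ τ_int^{ALT}(g)`**. -/
theorem mixture_tauInt_le_alt (hw0 : ∀ t, 0 < w t) (hwm : Measurable w) (hwi : Integrable w μ)
    (hq1p : ∀ t, 0 < q₁ t) (hq1m : Measurable q₁) (hq1i : Integrable q₁ μ) (hq1n : ∫ t, q₁ t ∂μ = 1)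
    (hq2p : ∀ t, 0 < q₂ t) (hq2m : Measurable q₂) (hq2i : Integrable q₂ μ) (hq2n : ∫ t, q₂ t ∂μ = 1)
    (ha0 : 0 ≤ a) (ha1 : a ≤ 1) {g : X → ℝ} (hgm : Measurable g)
    (hg2 : Integrable (fun t => g t ^ 2 * w t) μ) (hP : 0 < ∫ t, g t ^ 2 * w t ∂μ)
    (hs : Summable fun n => (∫ x, g x * (((fun f : X → ℝ => fun x =>
        a * imhOp μ w q₁ f x + (1 - a) * imhOp μ w q₂ f x)^[n + 1] g) x) * w x ∂μ)
      / ∫ x, g x ^ 2 * w x ∂μ) :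
    (Summable fun n => (∫ x, g x * ((imhOp μ w (fun s => a * q₁ s + (1 - a) * q₂ s))^[n + 1] g) x
        * w x ∂μ) / ∫ x, g x ^ 2 * w x ∂μ) ∧
    tauInt (fun n => (∫ x, g x * ((imhOp μ w (fun s => a * q₁ s + (1 - a) * q₂ s))^[n] g) x
        * w x ∂μ) / ∫ x, g x ^ 2 * w x ∂μ)
      ≤ tauInt (fun n => (∫ x, g x * (((fun f : X → ℝ => fun x =>
          a * imhOp μ w q₁ f x + (1 - a) * imhOp μ w q₂ f x)^[n] g) x) * w x ∂μ)
          / ∫ x, g x ^ 2 * w x ∂μ) := by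
  obtain ⟨hs0, hsm, hsi, hs1⟩ := mixture_facts (μ := μ) ha0 ha1 hq1p hq1m hq1i hq1n hq2p hq2m hq2i hq2n
  set P := ∫ x, g x ^ 2 * w x ∂μ with hPdef
  set Calt : ℕ → ℝ := fun k => ∫ x, g x * (((fun f : X → ℝ => fun x =>
      a * imhOp μ w q₁ f x + (1 - a) * imhOp μ w q₂ f x)^[k] g) x) * w x ∂μ with hCalt
  set T := ∑' k, Calt k / P with hT
  -- nonnegativity of the (ALT) autocovariances: each is a convex combination?  Not needed termwise —
  -- we only need `T ≥ 0`, which follows from the variational inequality at `v = g`.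
  have hvarALT : ∀ ⦃v : X → ℝ⦄, (Measurable v ∧ Integrable (fun t => v t ^ 2 * w t) μ) →
      (∫ x, g x * v x * w x ∂μ) ^ 2
        ≤ P * (T * ((∫ x, v x ^ 2 * w x ∂μ)
          - ∫ x, v x * (a * imhOp μ w q₁ v x + (1 - a) * imhOp μ w q₂ v x) * w x ∂μ)) :=
    fun v hv => RevOp.sq_inner_le_tsum_mul_dirichlet (A := fun f : X → ℝ =>
        Measurable f ∧ Integrable (fun t => f t ^ 2 * w t) μ)
      (K := fun f : X → ℝ => fun x => a * imhOp μ w q₁ f x + (1 - a) * imhOp μ w q₂ f x)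
      (fun x => (hw0 x).le) (sqClass_int hw0 hwm) (sqClass_comb hw0 hwm)
      (altOp_stab hw0 hwm hwi hq1p hq1m hq1i hq1n hq2p hq2m hq2i hq2n a)
      (altOp_lin hw0 hwm hwi hq1p hq1m hq1i hq2p hq2m hq2i a)
      (altOp_symm hw0 hwm hwi hq1p hq1m hq1i hq1n hq2p hq2m hq2i hq2n a)
      (altOp_contr hw0 hwm hwi hq1p hq1m hq1i hq1n hq2p hq2m hq2i hq2n ha0 ha1) ⟨hgm, hg2⟩ hv hs
  -- `T ≥ 0`: take `v = g` (`𝓔_alt(g) ≥ 0` by contraction + Cauchy–Schwarz is not needed: use `P² ≤ P T 𝓔`)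
  have hEg : 0 ≤ (∫ x, g x ^ 2 * w x ∂μ)
      - ∫ x, g x * (a * imhOp μ w q₁ g x + (1 - a) * imhOp μ w q₂ g x) * w x ∂μ := by
    have h := mixture_dirichlet_ge_alt hw0 hwm hwi hq1p hq1m hq1i hq1n hq2p hq2m hq2i hq2n ha0 ha1
      hgm hg2
    -- `𝓔_alt(g) = a 𝓔₁(g) + (1 − a) 𝓔₂(g) ≥ 0` from the two nonnegative Dirichlet forms
    have d1 := dirichlet_eq_half_sq_of_sq hw0 hwm hwi hq1p hq1m hq1i hq1n hgm hg2
    have d2 := dirichlet_eq_half_sq_of_sq hw0 hwm hwi hq2p hq2m hq2i hq2n hgm hg2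
    have n1 : 0 ≤ (1 / 2 : ℝ) * ∫ p, imhFlow w q₁ p.1 p.2 * (g p.1 - g p.2) ^ 2 ∂(μ.prod μ) :=
      mul_nonneg (by norm_num) (integral_nonneg fun p =>
        mul_nonneg (imhFlow_nonneg_le hw0 hq1p p.1 p.2).1 (sq_nonneg _))
    have n2 : 0 ≤ (1 / 2 : ℝ) * ∫ p, imhFlow w q₂ p.1 p.2 * (g p.1 - g p.2) ^ 2 ∂(μ.prod μ) :=
      mul_nonneg (by norm_num) (integral_nonneg fun p =>
        mul_nonneg (imhFlow_nonneg_le hw0 hq2p p.1 p.2).1 (sq_nonneg _))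
    have j1 := sqClass_int hw0 hwm ⟨hgm, hg2⟩ (sqClass_stab hw0 hwm hwi hq1p hq1m hq1i hq1n ⟨hgm, hg2⟩)
    have j2 := sqClass_int hw0 hwm ⟨hgm, hg2⟩ (sqClass_stab hw0 hwm hwi hq2p hq2m hq2i hq2n ⟨hgm, hg2⟩)
    have e : ∫ x, g x * (a * imhOp μ w q₁ g x + (1 - a) * imhOp μ w q₂ g x) * w x ∂μ
        = a * ∫ x, g x * imhOp μ w q₁ g x * w x ∂μ + (1 - a) * ∫ x, g x * imhOp μ w q₂ g x * w x ∂μ := by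
      have e' : ∀ x, g x * (a * imhOp μ w q₁ g x + (1 - a) * imhOp μ w q₂ g x) * w x
          = a * (g x * imhOp μ w q₁ g x * w x) + (1 - a) * (g x * imhOp μ w q₂ g x * w x) :=
        fun x => by ring
      simp_rw [e']
      rw [integral_add (j1.const_mul a) (j2.const_mul _), integral_const_mul, integral_const_mul]
    rw [e]
    nlinarith [d1, d2, n1, n2, ha0, sub_nonneg.2 ha1]
  have hT0 : 0 ≤ T := by
    have h := hvarALT ⟨hgm, hg2⟩
    have hgg : ∫ x, g x * g x * w x ∂μ = P := integral_congr_ae (Eventually.of_forall fun x => by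
      show g x * g x * w x = g x ^ 2 * w x; ring)
    rw [hgg] at h
    -- `P² ≤ P (T 𝓔)` with `P > 0`, `𝓔 ≥ 0` ⇒ `T ≥ 0`
    by_contra hneg
    have hT' : T < 0 := lt_of_not_ge hneg
    have : P * (T * ((∫ x, g x ^ 2 * w x ∂μ)
        - ∫ x, g x * (a * imhOp μ w q₁ g x + (1 - a) * imhOp μ w q₂ g x) * w x ∂μ)) ≤ 0 :=
      mul_nonpos_of_nonneg_of_nonpos hP.le (mul_nonpos_of_nonpos_of_nonneg hT'.le hEg)
    nlinarith
  -- the variational certificate `P T` for the MIXTURE sampler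
  have hvar : ∀ ⦃v : X → ℝ⦄, (Measurable v ∧ Integrable (fun t => v t ^ 2 * w t) μ) →
      (∫ x, g x * v x * w x ∂μ) ^ 2
        ≤ P * T * ((∫ x, v x ^ 2 * w x ∂μ)
          - ∫ x, v x * imhOp μ w (fun s => a * q₁ s + (1 - a) * q₂ s) v x * w x ∂μ) := by
    intro v hv
    have h1 := hvarALT hv
    have h2 := mixture_dirichlet_ge_alt hw0 hwm hwi hq1p hq1m hq1i hq1n hq2p hq2m hq2i hq2n ha0 ha1
      hv.1 hv.2
    calc (∫ x, g x * v x * w x ∂μ) ^ 2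
        ≤ P * (T * ((∫ x, v x ^ 2 * w x ∂μ)
          - ∫ x, v x * (a * imhOp μ w q₁ v x + (1 - a) * imhOp μ w q₂ v x) * w x ∂μ)) := h1
      _ ≤ P * (T * ((∫ x, v x ^ 2 * w x ∂μ)
          - ∫ x, v x * imhOp μ w (fun s => a * q₁ s + (1 - a) * q₂ s) v x * w x ∂μ)) :=
          mul_le_mul_of_nonneg_left (mul_le_mul_of_nonneg_left h2 hT0) hP.le
      _ = _ := by ring
  have hposMIX := (acceptanceCeiling_setup_of_sq hw0 hwm hwi hs0 hsm hsi hs1 hgm hg2).2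
  obtain ⟨hsum, hτ⟩ := RevOp.tauInt_le_of_forall_sq_inner_le_dirichlet_of_nonneg
    (A := fun f : X → ℝ => Measurable f ∧ Integrable (fun t => f t ^ 2 * w t) μ)
    (K := imhOp μ w (fun s => a * q₁ s + (1 - a) * q₂ s)) (sqClass_int hw0 hwm) (sqClass_comb hw0 hwm)
    (sqClass_stab hw0 hwm hwi hs0 hsm hsi hs1) (sqClass_lin hw0 hwm hwi hs0 hsm hsi)
    (sqClass_symm hw0 hwm hwi hs0 hsm hsi hs1) ⟨hgm, hg2⟩ hP hposMIX (mul_nonneg hP.le hT0) hvar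
  refine ⟨hsum, hτ.trans (le_of_eq ?_)⟩
  have hsum0 : Summable fun k => Calt k / P := (summable_nat_add_iff 1).1 hs
  have hC0 : Calt 0 / P = 1 := by
    have e : Calt 0 = P := by
      simp only [hCalt, hPdef, Function.iterate_zero, id_eq]
      exact integral_congr_ae (Eventually.of_forall fun x => by ring)
    rw [e, div_self hP.ne']
  have hTeq : T = 1 + ∑' k, Calt (k + 1) / P := by rw [hT, hsum0.tsum_eq_zero_add, hC0]
  show P * T / P - 1 / 2 = tauInt (fun n => Calt n / P)
  rw [mul_div_cancel_left₀ T hP.ne', hTeq]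
  unfold tauInt
  ring

end General

end Summit.Ventures.LatticeQCDFlow.Exactness
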